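import Literature.Geometry.Lorentzian.AsymptoticallyFlatCompleteness
import HarnessLib

/-!
# The chart of an asymptotically flat end: coordinate functions, two-sided comparison of `h`
# with `δ`, confinement of slow curves to the far region

Technical complements to `AsymptoticFlatness.lean` / `AsymptoticallyFlatCompleteness.lean` on an
asymptotically flat end `e : AFEnd X` of a `3`-manifold `X` with data `D` (all proved):

* `AFEnd.coord` — the chart of the end as a function `X → ℝ³` (junk `0` off the end), smooth on
  the end, with `coord (dataChart z) = z`, `dataChart (coord q) = q`, and
  `h_ij(coord q)(dcoord v)(dcoord v) = h_q(v, v)` (`hCoeff_coord_mfderiv`);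
  `AFEnd.dataChartExt` — the inverse chart as a function `ℝ³ → X` (junk inside the ball), smooth
  on the exterior region, with `h_ij(z) uⁱuʲ = h(dΦ u, dΦ u)`
  (`hCoeff_apply_eq_metric_dataChartExt`);
* `AFEnd.exists_radius_two_sided` — under the order-zero decay
  `h_ij - (1 + 2M/r)δ_ij = o(r^{-β})`, `β ≥ 0`, of `IsStronglyAsymptoticallyFlatWith`, there is
  `R₁` with `‖w‖² ≤ 2 h_ij wⁱwʲ ≤ 4‖w‖²` on `{‖y‖ ≥ R₁}` (Schoen–Yau 1979, p. 63: "`ds²` is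
  uniformly equivalent to the Euclidean metric");
* `AFEnd.isCompact_dataChart_closedBall` — closed chart balls far out are compact pieces of the
  far region; `AFEnd.confine` — **a differentiable curve of `h`-speed `≤ v` starting at a chart
  point `y₀` with `‖y₀‖ > R₁ + 2v` stays in the far region for unit time and its coordinate moves
  by `≤ 2vt`** (first-exit argument: the bad parameters form a closed set, before whose infimum
  the chain rule and the mean value inequality confine the coordinate to a compact chart ball).

These serve the packing argument of `EuclideanOfFlat.lean`.

## References

* R. Schoen, S.-T. Yau, *On the proof of the positive mass conjecture in general relativity*,
  Comm. Math. Phys. 65 (1979), §3, p. 63. [SchoenYauPMT1979]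
* R. Bartnik, *The mass of an asymptotically flat manifold*, CPAM 39 (1986), §1, (1.3).
  [Bartnik1986]
-/

noncomputable section

open Set Metric Filter Function Manifold Bundle
open scoped Topology ContDiff

namespace Literature.Geometry.Lorentzian

namespace AFEnd

variable {X : Type} [TopologicalSpace X] [ChartedSpace E3 X] [IsManifold (𝓡 3) ∞ X]
  (e : AFEnd X) (D : InitialDataSet (𝓡 3) X)

/-! ### The global coordinate function of the end -/

/-- **The coordinate function of the end**, extended by `0` off the end: `coord q = chart q`
for `q ∈ U`. [cite: Bartnik1986, §1] -/
def coord (q : X) : E3 :=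
  open scoped Classical in
  if hq : q ∈ e.U then (e.chart ⟨q, hq⟩ : E3) else 0

omit [IsManifold (𝓡 3) ∞ X] in
/-- On the end, `coord` is the chart. [folklore] -/
theorem coord_of_mem {q : X} (hq : q ∈ e.U) : e.coord q = (e.chart ⟨q, hq⟩ : E3) := by
  classical
  exact dif_pos hq

omit [IsManifold (𝓡 3) ∞ X] in
/-- `coord ∘ (inclusion of the end) = chart`. [folklore] -/
theorem coord_comp_val : (fun q : e.U ↦ e.coord q) = fun q ↦ (e.chart q : E3) := by
  funext q; rw [e.coord_of_mem q.2]

omit [IsManifold (𝓡 3) ∞ X] in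
/-- `coord (dataChart z) = z`. [folklore] -/
theorem coord_dataChart (z : exteriorRegion e.R) : e.coord (e.dataChart z) = (z : E3) := by
  have hz : e.dataChart z ∈ e.U := (e.chart.symm z).2
  rw [e.coord_of_mem hz]
  have : (⟨e.dataChart z, hz⟩ : e.U) = e.chart.symm z := rfl
  rw [this, Diffeomorph.apply_symm_apply]

omit [IsManifold (𝓡 3) ∞ X] in
/-- On the end the norm of the coordinate exceeds `R`. [folklore] -/
theorem lt_norm_coord {q : X} (hq : q ∈ e.U) : e.R < ‖e.coord q‖ := by
  rw [e.coord_of_mem hq]; exact (e.chart ⟨q, hq⟩).2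

omit [IsManifold (𝓡 3) ∞ X] in
/-- `dataChart (coord q) = q` on the end. [folklore] -/
theorem dataChart_coord {q : X} (hq : q ∈ e.U) :
    e.dataChart ⟨e.coord q, e.lt_norm_coord hq⟩ = q := by
  have h1 : (⟨e.coord q, e.lt_norm_coord hq⟩ : exteriorRegion e.R) = e.chart ⟨q, hq⟩ :=
    Subtype.ext (e.coord_of_mem hq)
  rw [h1]
  exact e.dataChart_chart ⟨q, hq⟩

omit [IsManifold (𝓡 3) ∞ X] in
/-- Membership in a far region through `dataChart`. [folklore] -/
theorem mem_far_iff {R' : ℝ} {q : X} :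
    q ∈ e.far R' ↔ ∃ z : exteriorRegion e.R, R' < ‖(z : E3)‖ ∧ e.dataChart z = q := by
  constructor
  · rintro ⟨y, hy, rfl⟩
    exact ⟨e.chart y, hy, e.dataChart_chart y⟩
  · rintro ⟨z, hz, rfl⟩
    refine ⟨e.chart.symm z, ?_, rfl⟩
    show R' < ‖(e.chart (e.chart.symm z) : E3)‖
    rwa [Diffeomorph.apply_symm_apply]

omit [IsManifold (𝓡 3) ∞ X] in
/-- Points of a far region lie in the end, with large coordinate. [folklore] -/
theorem mem_far_iff_coord {R' : ℝ} {q : X} :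
    q ∈ e.far R' ↔ ∃ _ : q ∈ e.U, R' < ‖e.coord q‖ := by
  rw [e.mem_far_iff]
  constructor
  · rintro ⟨z, hz, rfl⟩
    exact ⟨(e.chart.symm z).2, by rwa [e.coord_dataChart]⟩
  · rintro ⟨hq, hR⟩
    exact ⟨⟨e.coord q, e.lt_norm_coord hq⟩, hR, e.dataChart_coord hq⟩

omit [IsManifold (𝓡 3) ∞ X] in
/-- `coord` is smooth on the end. [folklore] -/
theorem contMDiffAt_coord {q : X} (hq : q ∈ e.U) : ContMDiffAt (𝓡 3) 𝓘(ℝ, E3) ∞ e.coord q := by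
  have h : ContMDiff (𝓡 3) 𝓘(ℝ, E3) ∞ (fun q : e.U ↦ e.coord q) := by
    rw [e.coord_comp_val]; exact contMDiff_subtype_val.comp e.chart.contMDiff
  exact contMDiffAt_subtype_iff.1 (h ⟨q, hq⟩)

omit [IsManifold (𝓡 3) ∞ X] in
/-- The differential of `coord` on the end is the differential of the chart. [folklore] -/
theorem mfderiv_coord_comp_val (q : e.U) (v : TangentSpace (𝓡 3) q) :
    mfderiv (𝓡 3) 𝓘(ℝ, E3) e.coord (q : X) v = mfderiv (𝓡 3) (𝓡 3) e.chart q v := by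
  have hd : MDifferentiableAt (𝓡 3) 𝓘(ℝ, E3) e.coord (q : X) :=
    (e.contMDiffAt_coord q.2).mdifferentiableAt (by simp)
  rw [← mfderiv_comp_subtypeVal hd]
  show mfderiv (𝓡 3) 𝓘(ℝ, E3) (fun q : e.U ↦ e.coord q) q v = _
  rw [e.coord_comp_val]
  have hc : MDifferentiableAt (𝓡 3) (𝓡 3) e.chart q := e.chart.contMDiff.mdifferentiableAt (by simp)
  have h1 : mfderiv (𝓡 3) 𝓘(ℝ, E3) (fun q : e.U ↦ (e.chart q : E3)) q =
      (mfderiv (𝓡 3) (𝓡 3) (Subtype.val : exteriorRegion e.R → E3) (e.chart q)).comp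
        (mfderiv (𝓡 3) (𝓡 3) e.chart q) :=
    mfderiv_comp q (hasMFDerivAt_subtypeVal (e.chart q)).mdifferentiableAt hc
  rw [h1, mfderiv_subtypeVal]
  rfl

/-- **The chart components evaluate the metric, through `coord`**: for `q` in the end and a
tangent vector `v`, `h_ij(coord q) (dcoord v) (dcoord v) = h_q(v, v)`. [cite: Bartnik1986, (1.3)] -/
theorem hCoeff_coord_mfderiv (q : e.U) (v : TangentSpace (𝓡 3) (q : X)) :
    hCoeff e D (e.coord q) (mfderiv (𝓡 3) 𝓘(ℝ, E3) e.coord q v)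
      (mfderiv (𝓡 3) 𝓘(ℝ, E3) e.coord q v) = D.metric.val (q : X) v v := by
  have h := e.hCoeff_chart_apply_mfderiv D q v
  rw [← e.mfderiv_coord_comp_val q v, ← e.coord_of_mem q.2] at h
  exact h

/-- **The chart components evaluate the metric on chart directions**: for a point `z` of the
exterior region and `u ∈ ℝ³`, `h_ij(z) uⁱ uʲ = h(dΦ u, dΦ u)` with `Φ = dataChart` (the
definition of the chart components as a pullback). [cite: Bartnik1986, (1.3)] -/
theorem hCoeff_apply_eq_metric_dataChart (z : exteriorRegion e.R) (u : E3) :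
    hCoeff e D (z : E3) u u = D.metric.val (e.dataChart z)
      (mfderiv (𝓡 3) (𝓡 3) e.dataChart z u) (mfderiv (𝓡 3) (𝓡 3) e.dataChart z u) := by
  rw [e.hCoeff_coe D z]
  rfl

/-! ### The inverse chart extended to all of `ℝ³` -/

/-- A point of the exterior region on the first axis (used as a junk value). [folklore] -/
def baseExterior : exteriorRegion e.R :=
  ⟨(e.R + 1) • EuclideanSpace.single (0 : Fin 3) (1 : ℝ), by
    rw [mem_exteriorRegion, norm_smul, Real.norm_of_nonneg (by linarith [e.R_pos])]
    have : ‖(EuclideanSpace.single (0 : Fin 3) (1 : ℝ) : E3)‖ = 1 := by simp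
    rw [this, mul_one]
    linarith⟩

/-- **The inverse chart as a map `ℝ³ → X`**, extended by a junk value inside the ball:
`dataChartExt z = dataChart z` for `‖z‖ > R`. [cite: Bartnik1986, §1] -/
def dataChartExt (z : E3) : X :=
  open scoped Classical in
  if hz : e.R < ‖z‖ then e.dataChart ⟨z, hz⟩ else e.dataChart e.baseExterior

omit [IsManifold (𝓡 3) ∞ X] in
/-- On the exterior region, `dataChartExt` is `dataChart`. [folklore] -/
theorem dataChartExt_of_lt {z : E3} (hz : e.R < ‖z‖) : e.dataChartExt z = e.dataChart ⟨z, hz⟩ := by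
  classical
  exact dif_pos hz

omit [IsManifold (𝓡 3) ∞ X] in
/-- `dataChartExt ∘ Subtype.val = dataChart`. [folklore] -/
theorem dataChartExt_comp_val :
    (fun z : exteriorRegion e.R ↦ e.dataChartExt (z : E3)) = e.dataChart := by
  funext z; rw [e.dataChartExt_of_lt z.2]

omit [IsManifold (𝓡 3) ∞ X] in
/-- `dataChartExt` is smooth on the exterior region. [folklore] -/
theorem contMDiffAt_dataChartExt {z : E3} (hz : e.R < ‖z‖) :
    ContMDiffAt 𝓘(ℝ, E3) (𝓡 3) ∞ e.dataChartExt z := by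
  have h := e.contMDiff_dataChart ⟨z, hz⟩
  rw [← e.dataChartExt_comp_val] at h
  exact (contMDiffAt_subtype_iff (U := exteriorRegion e.R) (f := e.dataChartExt) (x := ⟨z, hz⟩)).1 h

omit [IsManifold (𝓡 3) ∞ X] in
/-- The differential of `dataChart` is the differential of `dataChartExt`. [folklore] -/
theorem mfderiv_dataChart_eq (z : exteriorRegion e.R) (u : E3) :
    mfderiv (𝓡 3) (𝓡 3) e.dataChart z u = mfderiv 𝓘(ℝ, E3) (𝓡 3) e.dataChartExt (z : E3) u := by
  have hd : MDifferentiableAt 𝓘(ℝ, E3) (𝓡 3) e.dataChartExt (z : E3) :=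
    (e.contMDiffAt_dataChartExt z.2).mdifferentiableAt (by simp)
  rw [← e.dataChartExt_comp_val]
  exact DFunLike.congr_fun (mfderiv_comp_subtypeVal (W := exteriorRegion e.R) hd) u

/-- **The chart components evaluate the metric on chart directions, through `dataChartExt`.**
[cite: Bartnik1986, (1.3)] -/
theorem hCoeff_apply_eq_metric_dataChartExt {z : E3} (hz : e.R < ‖z‖) (u : E3) :
    hCoeff e D z u u = D.metric.val (e.dataChartExt z)
      (mfderiv 𝓘(ℝ, E3) (𝓡 3) e.dataChartExt z u) (mfderiv 𝓘(ℝ, E3) (𝓡 3) e.dataChartExt z u) := by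
  have h := e.hCoeff_apply_eq_metric_dataChart D ⟨z, hz⟩ u
  rw [e.mfderiv_dataChart_eq] at h
  rw [e.dataChartExt_of_lt hz]
  exact h

/-! ### Two-sided comparison of `h` with the Euclidean metric far out -/

-- the operator norm on `E3 →L[ℝ] E3 →L[ℝ] ℝ` is slow to synthesize through `PiLp`
set_option synthInstance.maxHeartbeats 80000 in
variable {e D} in
/-- **Far out, `h` is uniformly equivalent to `δ` with constant `2`**: under the order-zero
decay `h_ij - (1 + 2M/r) δ_ij = o(r^{-β})`, `β ≥ 0`, there is `R₁ > R` with
`‖w‖² ≤ 2 h_ij(y) wⁱwʲ ≤ 4 ‖w‖²` for `‖y‖ ≥ R₁` (Schoen–Yau 1979, p. 63: "`ds²` is uniformly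
equivalent to the Euclidean metric"). [cite: SchoenYauPMT1979, §3 p. 63] -/
theorem exists_radius_two_sided {M β γ : ℝ} {nh nk : ℕ} (hβ : 0 ≤ β)
    (h : e.IsStronglyAsymptoticallyFlatWith D M β γ nh nk) :
    ∃ R₁ : ℝ, e.R < R₁ ∧ 0 < R₁ ∧
      (∀ y : E3, R₁ ≤ ‖y‖ → ∀ w : E3, ‖w‖ ^ 2 ≤ 2 * hCoeff e D y w w) ∧
      ∀ y : E3, R₁ ≤ ‖y‖ → ∀ w : E3, hCoeff e D y w w ≤ 2 * ‖w‖ ^ 2 := by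
  obtain ⟨R₀, hR₀, hR₀0, hlow⟩ := exists_radius_norm_sq_le hβ h
  have h0 := h.1 0 (Nat.zero_le _)
  have h1 : ∀ᶠ y in Bornology.cobounded E3,
      ‖hCoeff e D y - (1 + 2 * M / ‖y‖) • (innerSL ℝ : E3 →L[ℝ] E3 →L[ℝ] ℝ)‖ ≤ 1 / 4 := by
    filter_upwards [h0.def (show (0 : ℝ) < 1 / 4 by norm_num),
      eventually_cobounded_le_norm (E := E3) 1] with y hy hy1
    rw [norm_iteratedFDeriv_zero, norm_norm] at hy
    refine hy.trans ?_
    have h2 : ‖y‖ ^ (-β - ((0 : ℕ) : ℝ)) ≤ 1 := by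
      rw [Nat.cast_zero, sub_zero]
      exact Real.rpow_le_one_of_one_le_of_nonpos hy1 (by linarith)
    rw [Real.norm_of_nonneg (Real.rpow_nonneg (norm_nonneg _) _)]
    calc 1 / 4 * ‖y‖ ^ (-β - ((0 : ℕ) : ℝ)) ≤ 1 / 4 * 1 := mul_le_mul_of_nonneg_left h2 (by norm_num)
      _ = 1 / 4 := by norm_num
  have h3 : ∀ᶠ y in Bornology.cobounded E3, |2 * M / ‖y‖| ≤ 1 / 4 := by
    filter_upwards [eventually_cobounded_le_norm (E := E3) (8 * |M| + 1)] with y hy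
    have hypos : 0 < ‖y‖ := by linarith [abs_nonneg M]
    rw [abs_div, abs_norm, div_le_iff₀ hypos, abs_mul, abs_two]
    nlinarith [abs_nonneg M]
  obtain ⟨r, -, hr⟩ := (Filter.hasBasis_cobounded_norm (E := E3)).eventually_iff.1 (h1.and h3)
  refine ⟨max r R₀, lt_of_lt_of_le hR₀ (le_max_right _ _), lt_of_lt_of_le hR₀0 (le_max_right _ _),
    fun y hy w ↦ hlow y ((le_max_right _ _).trans hy) w, fun y hy w ↦ ?_⟩
  obtain ⟨hA, hM⟩ := hr (show r ≤ ‖y‖ from (le_max_left _ _).trans hy)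
  set A := hCoeff e D y - (1 + 2 * M / ‖y‖) • (innerSL ℝ : E3 →L[ℝ] E3 →L[ℝ] ℝ) with hA_def
  have hδ : (innerSL ℝ : E3 →L[ℝ] E3 →L[ℝ] ℝ) w w = ‖w‖ ^ 2 := by
    rw [← real_inner_self_eq_norm_sq]
    rfl
  have hdec : hCoeff e D y w w = A w w + (1 + 2 * M / ‖y‖) * ‖w‖ ^ 2 := by
    simp only [hA_def, sub_apply, smul_apply, smul_eq_mul, hδ]
    ring
  have hAw : |A w w| ≤ 1 / 4 * ‖w‖ ^ 2 := by
    rw [← Real.norm_eq_abs]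
    calc ‖A w w‖ ≤ ‖A‖ * ‖w‖ * ‖w‖ := A.le_opNorm₂ w w
      _ ≤ 1 / 4 * ‖w‖ * ‖w‖ := by gcongr
      _ = 1 / 4 * ‖w‖ ^ 2 := by ring
  have hM' : 1 + 2 * M / ‖y‖ ≤ 5 / 4 := by linarith [(abs_le.1 hM).2]
  rw [hdec]
  nlinarith [(abs_le.1 hAw).2, sq_nonneg ‖w‖]

/-! ### Compact chart pieces and confinement of slow curves to the far region -/

omit [IsManifold (𝓡 3) ∞ X] in
/-- **Closed chart balls far out are compact pieces of the end inside the far region**: for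
`‖y₀‖ > R' + ρ`, `R' ≥ R`, the image under `dataChart` of the closed ball `‖z - y₀‖ ≤ ρ` is
compact and contained in `far R'`. [folklore] -/
theorem isCompact_dataChart_closedBall {y₀ : E3} {ρ R' : ℝ} (hR' : e.R ≤ R')
    (h : R' + ρ < ‖y₀‖) :
    IsCompact (e.dataChart '' ((Subtype.val : exteriorRegion e.R → E3) ⁻¹' closedBall y₀ ρ)) ∧
      e.dataChart '' ((Subtype.val : exteriorRegion e.R → E3) ⁻¹' closedBall y₀ ρ) ⊆ e.far R' := by
  have hnorm : ∀ y ∈ closedBall y₀ ρ, R' < ‖y‖ := fun y hy ↦ by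
    rw [mem_closedBall, dist_eq_norm] at hy
    have := norm_sub_norm_le y₀ y
    rw [← norm_neg (y₀ - y), neg_sub] at this
    linarith
  have hsub : closedBall y₀ ρ ⊆ range (Subtype.val : exteriorRegion e.R → E3) := fun y hy ↦ by
    rw [Subtype.range_coe_subtype]
    exact mem_exteriorRegion.2 (lt_of_le_of_lt hR' (hnorm y hy))
  have hB'c : IsCompact ((Subtype.val : exteriorRegion e.R → E3) ⁻¹' closedBall y₀ ρ) := by
    rw [Topology.IsEmbedding.subtypeVal.isCompact_iff, image_preimage_eq_inter_range,
      inter_eq_left.2 hsub]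
    exact isCompact_closedBall _ _
  refine ⟨hB'c.image e.contMDiff_dataChart.continuous, ?_⟩
  rintro _ ⟨z, hz, rfl⟩
  exact e.mem_far_iff.2 ⟨z, hnorm _ hz, rfl⟩

omit [IsManifold (𝓡 3) ∞ X] in
/-- The chain rule for `coord` along a curve in the end: `(coord ∘ σ)'(u) = dcoord(σ'(u))`.
[folklore] -/
theorem hasDerivAt_coord_comp {σ : ℝ → X} {u : ℝ} (hσ : MDifferentiableAt 𝓘(ℝ, ℝ) (𝓡 3) σ u)
    (hu : σ u ∈ e.U) :
    HasDerivAt (e.coord ∘ σ) (mfderiv (𝓡 3) 𝓘(ℝ, E3) e.coord (σ u) (velocity (𝓡 3) σ u)) u := by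
  have h₁ : HasMFDerivAt (𝓡 3) 𝓘(ℝ, E3) e.coord (σ u) (mfderiv (𝓡 3) 𝓘(ℝ, E3) e.coord (σ u)) :=
    ((e.contMDiffAt_coord hu).mdifferentiableAt (by simp)).hasMFDerivAt
  have h₂ := h₁.comp u hσ.hasMFDerivAt
  rw [hasMFDerivAt_iff_hasFDerivAt] at h₂
  set L : ℝ →L[ℝ] E3 := (mfderiv (𝓡 3) 𝓘(ℝ, E3) e.coord (σ u)).comp (mfderiv 𝓘(ℝ, ℝ) (𝓡 3) σ u)
    with hL
  have h₃ : HasFDerivAt (e.coord ∘ σ) L u := h₂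
  exact h₃.hasDerivAt

/-- **Confinement of slow curves to the far region.** Let `σ : ℝ → X` be differentiable with
`h(σ', σ') ≤ v²`, starting at `σ 0 = Φ(y₀)` with `‖y₀‖ > R₁ + 2v`, where on `{‖y‖ ≥ R₁}`,
`R₁ ≥ R`, the coordinate norm is dominated by the metric, `‖w‖² ≤ 2 h_ij wⁱwʲ`. Then on `[0, 1]`
the curve stays in the end and its coordinate moves by at most `2 v t`:
the set of bad parameters is closed, and before its infimum the chain rule and the mean value
inequality bound the coordinate displacement, so by compactness of closed chart balls
(`isCompact_dataChart_closedBall`) the infimum is not bad. (The first-exit argument behind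
"`N ∖ N_k` is compact … `ds²` uniformly equivalent to the Euclidean metric", Schoen–Yau 1979,
p. 63.) [cite: SchoenYauPMT1979, §3 p. 63] -/
theorem confine [T2Space X] {σ : ℝ → X} (hσ : ∀ t, MDifferentiableAt 𝓘(ℝ, ℝ) (𝓡 3) σ t)
    {v : ℝ} (hv : 0 ≤ v)
    (hspeed : ∀ t, D.metric.val (σ t) (velocity (𝓡 3) σ t) (velocity (𝓡 3) σ t) ≤ v ^ 2)
    {R₁ : ℝ} (hR₁ : e.R ≤ R₁)
    (hlow : ∀ y : E3, R₁ ≤ ‖y‖ → ∀ w : E3, ‖w‖ ^ 2 ≤ 2 * hCoeff e D y w w)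
    {y₀ : exteriorRegion e.R} (h0 : σ 0 = e.dataChart y₀) (hfar : R₁ + 2 * v < ‖(y₀ : E3)‖)
    {t : ℝ} (ht : t ∈ Icc (0 : ℝ) 1) :
    σ t ∈ e.far R₁ ∧ ‖e.coord (σ t) - y₀‖ ≤ 2 * v * t := by
  have hσc : Continuous σ := continuous_iff_continuousAt.2 fun t ↦ (hσ t).continuousAt
  have hfarU : e.far R₁ ⊆ e.U := e.far_subset R₁
  have hy₀ : e.coord (σ 0) = y₀ := by rw [h0, e.coord_dataChart]
  have h0far : σ 0 ∈ e.far R₁ := by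
    rw [h0]; exact e.mem_far_iff.2 ⟨y₀, by linarith [mul_nonneg two_pos.le hv], rfl⟩
  -- derivative bound at points of the far region
  have hderiv : ∀ u, σ u ∈ e.far R₁ →
      HasDerivAt (e.coord ∘ σ) (mfderiv (𝓡 3) 𝓘(ℝ, E3) e.coord (σ u) (velocity (𝓡 3) σ u)) u ∧
      ‖(show E3 from mfderiv (𝓡 3) 𝓘(ℝ, E3) e.coord (σ u) (velocity (𝓡 3) σ u))‖ ≤ 2 * v := by
    intro u hu
    obtain ⟨huU, huR⟩ := e.mem_far_iff_coord.1 hu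
    refine ⟨e.hasDerivAt_coord_comp (hσ u) huU, ?_⟩
    set w : E3 := mfderiv (𝓡 3) 𝓘(ℝ, E3) e.coord (σ u) (velocity (𝓡 3) σ u) with hw
    show ‖w‖ ≤ 2 * v
    have h1 := hlow (e.coord (σ u)) huR.le w
    have h2 : hCoeff e D (e.coord (σ u)) w w = D.metric.val (σ u) (velocity (𝓡 3) σ u)
        (velocity (𝓡 3) σ u) := e.hCoeff_coord_mfderiv D ⟨σ u, huU⟩ _
    rw [h2] at h1
    have h3 : ‖w‖ ^ 2 ≤ (2 * v) ^ 2 := by nlinarith [hspeed u]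
    exact (pow_le_pow_iff_left₀ (norm_nonneg _) (by positivity) two_ne_zero).1 h3
  -- the mean value bound on an initial segment inside the far region
  have hmvt : ∀ t₁, (∀ u ∈ Icc (0 : ℝ) t₁, σ u ∈ e.far R₁) →
      ∀ u ∈ Icc (0 : ℝ) t₁, ‖e.coord (σ u) - y₀‖ ≤ 2 * v * u := by
    intro t₁ hgood u hu
    have key := norm_image_sub_le_of_norm_deriv_le_segment' (f := e.coord ∘ σ) (a := 0) (b := t₁)
      (f' := fun u ↦ (show E3 from mfderiv (𝓡 3) 𝓘(ℝ, E3) e.coord (σ u) (velocity (𝓡 3) σ u)))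
      (fun x hx ↦ ((hderiv x (hgood x hx)).1).hasDerivWithinAt)
      (fun x hx ↦ (hderiv x (hgood x (Ico_subset_Icc_self hx))).2) u hu
    simp only [Function.comp_apply, sub_zero, hy₀] at key
    exact key
  -- the bad set is empty
  have hall : ∀ u ∈ Icc (0 : ℝ) 1, σ u ∈ e.far R₁ := by
    by_contra hcon
    push Not at hcon
    set Bad : Set ℝ := {u | u ∈ Icc (0 : ℝ) 1 ∧ σ u ∉ e.far R₁} with hBad
    have hne : Bad.Nonempty := by obtain ⟨u, hu, hbad⟩ := hcon; exact ⟨u, hu, hbad⟩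
    have hclosed : IsClosed Bad :=
      isClosed_Icc.inter ((e.isOpen_far R₁).isClosed_compl.preimage hσc)
    have hbdd : BddBelow Bad := ⟨0, fun u hu ↦ hu.1.1⟩
    set t₁ := sInf Bad with ht₁
    have hmem : t₁ ∈ Bad := hclosed.csInf_mem hne hbdd
    have hlt : ∀ u, 0 ≤ u → u < t₁ → σ u ∈ e.far R₁ := by
      intro u hu0 hut
      by_contra hbad
      have hu1 : u ≤ 1 := (hut.le.trans hmem.1.2)
      exact absurd (csInf_le hbdd ⟨⟨hu0, hu1⟩, hbad⟩) (not_le.2 hut)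
    have ht₁pos : 0 < t₁ := lt_of_le_of_ne hmem.1.1 fun h ↦ hmem.2 (by rw [← h]; exact h0far)
    -- on `[0, t₁)` the coordinate stays in the closed ball of radius `2 v` around `y₀`
    obtain ⟨hKc, hKfar⟩ := e.isCompact_dataChart_closedBall (y₀ := (y₀ : E3)) (ρ := 2 * v)
      (R' := R₁) hR₁ hfar
    set K := e.dataChart '' ((Subtype.val : exteriorRegion e.R → E3) ⁻¹' closedBall (y₀ : E3) (2 * v))
      with hK
    have hinK : ∀ u ∈ Ico (0 : ℝ) t₁, σ u ∈ K := by
      intro u hu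
      have hgood : ∀ u' ∈ Icc (0 : ℝ) u, σ u' ∈ e.far R₁ :=
        fun u' hu' ↦ hlt u' hu'.1 (lt_of_le_of_lt hu'.2 hu.2)
      have hb := hmvt u hgood u ⟨hu.1, le_rfl⟩
      obtain ⟨huU, -⟩ := e.mem_far_iff_coord.1 (hgood u ⟨hu.1, le_rfl⟩)
      refine ⟨⟨e.coord (σ u), e.lt_norm_coord huU⟩, ?_, e.dataChart_coord huU⟩
      show e.coord (σ u) ∈ closedBall (y₀ : E3) (2 * v)
      rw [mem_closedBall, dist_eq_norm]
      calc ‖e.coord (σ u) - y₀‖ ≤ 2 * v * u := hb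
        _ ≤ 2 * v * 1 := by
            refine mul_le_mul_of_nonneg_left (hu.2.le.trans hmem.1.2) (by positivity)
        _ = 2 * v := mul_one _
    -- hence `σ t₁ ∈ K ⊆ far R₁`, a contradiction
    have hcl : σ t₁ ∈ closure (σ '' Ico (0 : ℝ) t₁) := by
      refine image_closure_subset_closure_image hσc ⟨t₁, ?_, rfl⟩
      rw [closure_Ico ht₁pos.ne]; exact ⟨ht₁pos.le, le_rfl⟩
    have hKcl : closure (σ '' Ico (0 : ℝ) t₁) ⊆ K :=
      hKc.isClosed.closure_subset_iff.2 (by rintro _ ⟨u, hu, rfl⟩; exact hinK u hu)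
    exact hmem.2 (hKfar (hKcl hcl))
  exact ⟨hall t ht, hmvt 1 hall t ht⟩

end AFEnd

end Literature.Geometry.Lorentzian

end
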